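import Summits.BirchSwinnertonDyer.BirchSwinnertonDyer.Theorems.EisensteinDepletionAtTwoStarPeriodAdditive
import Mathlib.GroupTheory.SpecificGroups.Cyclic
import HarnessLib

/-!
# Line `kummer` (v2) on crux `StarGO2Sigma` (item stmt-BirchSwinnertonDyer-27046, route `EisensteinDepletionAtTwo`):
# stub `stub_eisImageCyclic` — the period group `φ_β(Γ₀(N)) ⊂ ℚ` of the stabilised Eisenstein series is cyclic

Cell `bsd-rank2` (HOME run/shared/lean/pub/bsd-rank2/), seat `bsd-rank2-eng-2` GEN 16; registered stub 1a of planner p2 GEN 32's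
line `kummer` v2 (skeleton `line-kummer.lean`, namespace `…Cruxes.StarGO2Sigma.Kummer`), proved VERBATIM (name + signature).
Content: `φ_β = stabEisensteinPeriod N β` is a homomorphism on `Γ₀(N)` (TREE `stabEisensteinPeriod_mul / _one / _inv`), so its
value set is an additive subgroup of `ℚ`; it lies in `(1/rad N)·ℤ` — Rademacher's `Φ` is `ℤ`-valued on `SL₂(ℤ)` (TREE
`rademacherPhi_mem_int`, at the conjugate `(a, tb; c/t, d)`, `t ∣ c`) and `rad(N)·c_t ∈ ℤ` (`c_t = stabCoeff N β t` is a product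
over the primes `ℓ ∣ N` of `1, −β_ℓ/ℓ, −(1+ℓ)/ℓ, 1/ℓ, 0`) —; and a subgroup of the infinite cyclic group `(1/rad N)·ℤ` is cyclic
(Mathlib: subgroups of `ℤ` are cyclic).  So `φ_β(Γ₀(N)) = ℤ·g'`.
HONEST FRAMING: elementary bookkeeping stub of an OPEN crux; StarGO2Sigma / E1M_NSF / BSD are NOT proved by this file
(PARTITION D-0054: none — r_an ≥ 2 axis S0, door T-r3₂).

References: H. Rademacher, E. Grosswald, *Dedekind Sums*, Carus 16 (1972), Ch. 4 A, pp. 49–50 (`Φ(M) ∈ ℤ`) [RademacherGrosswald1972];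
G. Stevens, *Arithmetic on Modular Curves*, Progr. Math. 20 (1982), §2.5 (periods of Eisenstein series) [Stevens1982].
-/

set_option linter.dupNamespace false
set_option autoImplicit false

noncomputable section

namespace Summit.BirchSwinnertonDyer.BirchSwinnertonDyer.Theorems.DepletionAtTwo.KummerStubs

open scoped MatrixGroups
open CongruenceSubgroup Finset Literature.NumberTheory.ModularForms
open Summit.BirchSwinnertonDyer.BirchSwinnertonDyer.Theorems.DepletionAtTwo

/-! ### §1 Denominators: `rad(N)·φ_β(γ) ∈ ℤ` -/

/-- `ℓ · c_ℓ(j) ∈ ℤ` for every local stabilisation coefficient (`c_ℓ(j) ∈ {1, −β_ℓ/ℓ, −(1+ℓ)/ℓ, 1/ℓ, 0}`).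
[cite: Stevens1982, §2.4 (PDF pp. 35–37)] -/
theorem localStabCoeff_mul_self_mem_int (N : ℕ) (β : ℕ → ℕ) {ℓ : ℕ} (hℓ : ℓ ≠ 0) (j : ℕ) :
    ∃ z : ℤ, localStabCoeff N β ℓ j * ℓ = z := by
  have hℓq : (ℓ : ℚ) ≠ 0 := by exact_mod_cast hℓ
  unfold localStabCoeff
  split_ifs
  · exact ⟨ℓ, by push_cast; ring⟩
  · exact ⟨-(β ℓ : ℤ), by rw [div_mul_cancel₀ _ hℓq]; push_cast; ring⟩
  · exact ⟨0, by push_cast; ring⟩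
  · exact ⟨ℓ, by push_cast; ring⟩
  · exact ⟨-(1 + ℓ : ℤ), by rw [div_mul_cancel₀ _ hℓq]; push_cast; ring⟩
  · exact ⟨1, by rw [div_mul_cancel₀ _ hℓq]; push_cast; ring⟩
  · exact ⟨0, by push_cast; ring⟩
  · exact ⟨ℓ, by push_cast; ring⟩
  · exact ⟨0, by push_cast; ring⟩

/-- `rad(N) · c_t ∈ ℤ`, `rad(N) = ∏_{ℓ ∣ N} ℓ`. [cite: Stevens1982, §2.4 (PDF pp. 35–37)] -/
theorem stabCoeff_mul_rad_mem_int (N : ℕ) (β : ℕ → ℕ) (t : ℕ) :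
    ∃ z : ℤ, stabCoeff N β t * (∏ ℓ ∈ N.primeFactors, (ℓ : ℚ)) = z := by
  unfold stabCoeff
  rw [← prod_mul_distrib]
  refine prod_induction _ (fun q : ℚ => ∃ z : ℤ, q = z) ?_ ⟨1, by simp⟩ ?_
  · rintro a b ⟨za, rfl⟩ ⟨zb, rfl⟩
    exact ⟨za * zb, by push_cast; ring⟩
  · intro ℓ hℓ
    obtain ⟨z, hz⟩ := localStabCoeff_mul_self_mem_int N β (Nat.prime_of_mem_primeFactors hℓ).ne_zero
      (t.factorization ℓ)
    exact ⟨z, hz⟩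

/-- **`rad(N) · φ_β(a b; c d) ∈ ℤ`** for `ad − bc = 1`, `N ∣ c`: each `Φ(a, tb; c/t, d)` (`t ∣ N ∣ c`, determinant `1`) is
an integer (Rademacher–Grosswald pp. 49–50) and `rad(N) c_t ∈ ℤ`. [cite: RademacherGrosswald1972, Ch. 4 A, pp. 49–50] -/
theorem stabEisensteinPeriod_mul_rad_mem_int (N : ℕ) (β : ℕ → ℕ) {a b c d : ℤ} (hdet : a * d - b * c = 1)
    (hc : (N : ℤ) ∣ c) :
    ∃ z : ℤ, stabEisensteinPeriod N β a b c d * (∏ ℓ ∈ N.primeFactors, (ℓ : ℚ)) = z := by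
  rw [stabEisensteinPeriod_eq, sum_mul]
  refine sum_induction _ (fun q : ℚ => ∃ z : ℤ, q = z) ?_ ⟨0, by simp⟩ ?_
  · rintro x y ⟨zx, rfl⟩ ⟨zy, rfl⟩
    exact ⟨zx + zy, by push_cast; ring⟩
  · intro t ht
    have htc : (t : ℤ) ∣ c := (Int.natCast_dvd_natCast.mpr (Nat.dvd_of_mem_divisors ht)).trans hc
    have hdet' : a * d - (t * b) * (c / t) = 1 := by
      rw [mul_comm (t : ℤ) b, mul_assoc, Int.mul_ediv_cancel' htc]; exact hdet
    obtain ⟨n, hn⟩ := rademacherPhi_mem_int hdet'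
    obtain ⟨z, hz⟩ := stabCoeff_mul_rad_mem_int N β t
    refine ⟨n * z, ?_⟩
    rw [hn, mul_right_comm, hz]
    push_cast; ring

/-! ### §2 The stub -/

/-- **Stub `stub_eisImageCyclic` of line `kummer` v2 (crux StarGO2Sigma, item 27046), VERBATIM.**  For `N ≠ 0` and admissible
`β`, the value set `φ_β(Γ₀(N))` of the stabilised Eisenstein period is `ℤ·g'` for some `g' ∈ ℚ`: a homomorphic image of
`Γ₀(N)` inside `(1/rad N)·ℤ ≅ ℤ`, whose subgroups are cyclic. [cite: RademacherGrosswald1972, Ch. 4 A, pp. 49–50]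
[cite: Stevens1982, §2.5 (PDF p. 38)] -/
theorem stub_eisImageCyclic :
    ∀ (N : ℕ) (β : ℕ → ℕ), N ≠ 0 → IsAdmissibleStabData N β →
      ∃ g' : ℚ, ∀ x : ℚ,
        (∃ γ : Gamma0 N, stabEisensteinPeriod N β ((γ : SL(2, ℤ)) 0 0) ((γ : SL(2, ℤ)) 0 1)
            ((γ : SL(2, ℤ)) 1 0) ((γ : SL(2, ℤ)) 1 1) = x) ↔ ∃ n : ℤ, x = n * g' := by
  intro N β hN hadm
  -- notation
  set R : ℚ := ∏ ℓ ∈ N.primeFactors, (ℓ : ℚ) with hR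
  have hR0 : R ≠ 0 := prod_ne_zero_iff.mpr fun ℓ hℓ => by
    exact_mod_cast (Nat.prime_of_mem_primeFactors hℓ).ne_zero
  set φ : Gamma0 N → ℚ := fun γ => stabEisensteinPeriod N β ((γ : SL(2, ℤ)) 0 0) ((γ : SL(2, ℤ)) 0 1)
    ((γ : SL(2, ℤ)) 1 0) ((γ : SL(2, ℤ)) 1 1) with hφ
  -- `Γ₀(N)`-membership and the homomorphism laws
  have hmem : ∀ γ : Gamma0 N, (N : ℤ) ∣ (γ : SL(2, ℤ)) 1 0 := fun γ =>
    (ZMod.intCast_zmod_eq_zero_iff_dvd _ N).mp ((Gamma0_mem (N := N) (A := (γ : SL(2, ℤ)))).mp γ.2)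
  have hdetγ : ∀ γ : Gamma0 N, (γ : SL(2, ℤ)) 0 0 * (γ : SL(2, ℤ)) 1 1 - (γ : SL(2, ℤ)) 0 1 * (γ : SL(2, ℤ)) 1 0 = 1 :=
    fun γ => by rw [← Matrix.det_fin_two]; exact (γ : SL(2, ℤ)).det_coe
  have hmul : ∀ γ δ : Gamma0 N, φ (γ * δ) = φ γ + φ δ := by
    intro γ δ
    simp only [hφ, Subgroup.coe_mul]
    exact stabEisensteinPeriod_mul hN hadm (hmem γ) (hmem δ)
  have hone : φ 1 = 0 := by
    simp only [hφ, OneMemClass.coe_one]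
    exact stabEisensteinPeriod_one N β
  have hinv : ∀ γ : Gamma0 N, φ γ⁻¹ = -φ γ := by
    intro γ
    simp only [hφ, Subgroup.coe_inv]
    exact stabEisensteinPeriod_inv hN hadm (hmem γ)
  -- integrality: `R · φ γ ∈ ℤ`
  have hint : ∀ γ : Gamma0 N, ∃ z : ℤ, φ γ * R = z := fun γ =>
    stabEisensteinPeriod_mul_rad_mem_int N β (hdetγ γ) (hmem γ)
  -- the subgroup `T = R · φ(Γ₀(N)) ⊆ ℤ`
  let T : AddSubgroup ℤ :=
    { carrier := {m : ℤ | ∃ γ : Gamma0 N, φ γ * R = m}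
      zero_mem' := ⟨1, by rw [hone, zero_mul]; simp⟩
      add_mem' := by
        rintro x y ⟨γ, hγ⟩ ⟨δ, hδ⟩
        exact ⟨γ * δ, by rw [hmul, add_mul, hγ, hδ]; push_cast; ring⟩
      neg_mem' := by
        rintro x ⟨γ, hγ⟩
        exact ⟨γ⁻¹, by rw [hinv, neg_mul, hγ]; push_cast; ring⟩ }
  have hTmem : ∀ m : ℤ, m ∈ T ↔ ∃ γ : Gamma0 N, φ γ * R = m := fun m => Iff.rfl
  -- `T` is cyclic
  obtain ⟨g, hg⟩ := (inferInstance : IsAddCyclic T).exists_generator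
  refine ⟨(g : ℤ) / R, fun x => ⟨?_, ?_⟩⟩
  · rintro ⟨γ, hγx⟩
    obtain ⟨z, hz⟩ := hint γ
    have hzT : z ∈ T := (hTmem z).mpr ⟨γ, hz⟩
    obtain ⟨k, hk⟩ := (AddSubgroup.mem_zmultiples_iff.mp (hg ⟨z, hzT⟩))
    have hk' : k • (g : ℤ) = z := by
      have := congrArg (fun u : T => (u : ℤ)) hk
      simpa using this
    refine ⟨k, ?_⟩
    have e : φ γ = (z : ℚ) / R := by rw [← hz, mul_div_cancel_right₀ _ hR0]
    rw [← hγx, show stabEisensteinPeriod N β ((γ : SL(2, ℤ)) 0 0) ((γ : SL(2, ℤ)) 0 1) ((γ : SL(2, ℤ)) 1 0)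
      ((γ : SL(2, ℤ)) 1 1) = φ γ from rfl, e, ← hk', zsmul_eq_mul]
    push_cast
    ring
  · rintro ⟨n, rfl⟩
    have hngT : n • (g : ℤ) ∈ T := by
      have := (n • g).2
      simpa using this
    obtain ⟨γ, hγ⟩ := (hTmem _).mp hngT
    refine ⟨γ, ?_⟩
    have e : φ γ = ((n • (g : ℤ) : ℤ) : ℚ) / R := by rw [← hγ, mul_div_cancel_right₀ _ hR0]
    rw [show stabEisensteinPeriod N β ((γ : SL(2, ℤ)) 0 0) ((γ : SL(2, ℤ)) 0 1) ((γ : SL(2, ℤ)) 1 0)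
      ((γ : SL(2, ℤ)) 1 1) = φ γ from rfl, e, zsmul_eq_mul]
    push_cast
    ring

end Summit.BirchSwinnertonDyer.BirchSwinnertonDyer.Theorems.DepletionAtTwo.KummerStubs

end
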